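import Literature.Topology.FourManifolds.SphereChartOrientation
import Literature.Topology.FourManifolds.BandSumFoxMilnor
import Literature.Topology.FourManifolds.KnotFlatArc
import Literature.Topology.FourManifolds.LocalLinearisationIsotopy
import HarnessLib

/-!
# Fox–Milnor symmetric model, I: the stereographic chart, rays, the inversion and flat models

Topic `Literature/Topology/FourManifolds`; fact seat
`provefact-Literature.Topology.FourManifolds.Knot.isSmoothlySlice_of_isConnectedSum_mirror_reverse`
(`BandSum.lean`: **Fox–Milnor**, `K # (-K̄)` is smoothly slice; R. H. Fox, J. W. Milnor (1966),
§1; C. Livingston (2005), §2.1). The assembly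
`Knot.isSmoothlySlice_of_isConnectedSum_mirror_reverse_of` (`BandSumFoxMilnor.lean`) reduces the
fact to Schubert's uniqueness of connected sums, the isotopy invariance of sliceness (proved,
`SliceRibbonIsotopyProofs.lean`) and the existence, for every knot `K`, of ONE smoothly slice
connected sum of `K` and `K.mirror.reverse`; the chord disc theorem
`Knot.isSmoothlySlice_of_symmetric` (`BandSumFoxMilnor.lean`) proves sliceness of symmetric unions
`K ∪ R K` with vertical great-circle germs at the equator. This file and its sequels construct
such a symmetric union as an explicit connected sum (a *normal presentation*,
`Knot.IsNormalConnectedSum`, `ConnectedSumNormalForm.lean`) in the stereographic chart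
`ψ = KnotsInBall.psi` from the south pole, in which the equator `{x₃ = 0}` is the sphere of radius
`2`, the reflection `R = reflectLast 3` is the inversion in that sphere, and the vertical great
circles through the poles are the rays from the origin. Everything here is proved:

* `FoxMilnorModel.uvec` — the frame `U⁻¹ : ℝ³ → ℝ⁴` of the chart (a linear isometry onto the
  horizontal hyperplane `x₃ = 0`), and **the inverse chart in the frame**,
  `phi_eq : φ w = (‖w‖² + 4)⁻¹ (4 U⁻¹ w + (4 - ‖w‖²) e₃)` (`φ = (↑) ∘ ψ⁻¹`, `KnotsInBall.phi`), with
  the hemisphere criteria `phi_apply_three_pos_iff` / `_neg_iff` / `_eq_zero_iff` (`‖w‖ <, >, = 2`);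
* `FoxMilnorModel.refl4` (the reflection `R` on vectors) and `FoxMilnorModel.inv3` (the inversion
  `w ↦ 4 w / ‖w‖²`), with **`phi_inv3 : φ (ι w) = R (φ w)`**, `psi_symm_inv3`;
* `FoxMilnorModel.rayR θ = 2 cos θ / (1 + sin θ)` and **`phi_ray`**: `φ (rayR θ • a) =
  cos θ U⁻¹ a + sin θ e₃` — the rays of the chart are the vertical great circles through the poles,
  parametrised by the angle from the equator (the germs required by the chord disc theorem);
* `FoxMilnorModel.FlatModel` — a knot `A` off the south pole with chart image in `B(0, 2)` (i.e.
  in the open northern hemisphere), at height `≥ -1`, containing the horizontal segment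
  `{q + s e : |s| ≤ ℓ}` through `q = (0, 0, -1)` (`qbase`) traversed by a parameter window
  `[α, β]` through an increasing `σ`, and meeting the slab `{|⟪z - q, e⟫| < ℓ, z₂ < -1 + ν}` only
  in the segment; `exists_map_homothety` (transport of a knot by a homothety of the chart:
  `AffineIsotopy.exists_ambientIsotopy_affine` along `ψ`, `AmbientIsotopy.alongChart`) and
  **`exists_flatModel`: every knot is isotopic to the knot of a flat model**
  (`Knot.exists_flatArc_param`, `KnotFlatArc.lean`, rescaled).

## References

* R. H. Fox, J. W. Milnor, *Singularities of 2-spheres in 4-space and cobordism of knots*, Osaka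
  J. Math. 3 (1966), 257–267, §1. [FoxMilnor1966]
* C. Livingston, *A survey of classical knot concordance*, Handbook of Knot Theory (2005), §2.1
  (held: arXiv math/0307077, p. 3). [Livingston2005]
* M. W. Hirsch, *Differential Topology*, GTM 33 (1976), Ch. 8 §1, Thms. 1.3–1.4 (ambient isotopies
  from flows; used through the tree's `AffineAmbientIsotopy.lean`, `KnotFlatArc.lean`).
  [HirschDT1976]

## Design notes

No statement of another file is modified; no named fact is introduced (D-0026); no `sorry`.
`𝔼 n`, `𝕊 n` are local notation as in `Knots.lean`; `e3`, `projH` are those of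
`BandSumFoxMilnor.lean` (`Knot.SymmetricUnion`).
-/

open scoped Manifold ContDiff Topology Real RealInnerProductSpace
open Function Set Metric

noncomputable section

namespace Literature.Topology.FourManifolds

/-- Local notation: `𝔼 n` is the model Euclidean space `EuclideanSpace ℝ (Fin n)`. -/
local notation "𝔼 " n:arg => EuclideanSpace ℝ (Fin n)

/-- Local notation: `𝕊 n` is the unit sphere in `EuclideanSpace ℝ (Fin (n + 1))`. -/
local notation "𝕊 " n:arg => (Metric.sphere (0 : EuclideanSpace ℝ (Fin (n + 1))) 1)

attribute [local instance] fact_finrank_euclideanSpace_succ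

namespace FoxMilnorModel

open KnotsInBall Knot.SymmetricUnion

/-! ## The frame of the chart `ψ` -/

/-- The linear isometry `(ℝ ∙ s)ᗮ ≃ ℝ³` (`s` the south pole) used by the chart
`ψ = stereographic' 3 s` (`KnotsInBall.psi`). [folklore] -/
def U : (ℝ ∙ ((southPole : 𝕊 3) : 𝔼 4))ᗮ ≃ₗᵢ[ℝ] 𝔼 3 :=
  (OrthonormalBasis.fromOrthogonalSpanSingleton 3 (ne_zero_of_mem_unit_sphere southPole)).repr

/-- The frame of the chart: the horizontal vector `U⁻¹ y ∈ ℝ⁴` of the chart vector `y ∈ ℝ³`,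
as a linear isometry `ℝ³ → ℝ⁴` onto the horizontal hyperplane `x₃ = 0`. [folklore] -/
def uvec : 𝔼 3 →ₗᵢ[ℝ] 𝔼 4 :=
  (ℝ ∙ ((southPole : 𝕊 3) : 𝔼 4))ᗮ.subtypeₗᵢ.comp U.symm.toLinearIsometry

/-- Unfolding of `uvec`. [folklore] -/
theorem uvec_apply (y : 𝔼 3) : uvec y = ((U.symm y : (ℝ ∙ ((southPole : 𝕊 3) : 𝔼 4))ᗮ) : 𝔼 4) :=
  rfl

/-- `uvec y` is horizontal: orthogonal to the south pole. [folklore] -/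
theorem inner_southPole_uvec (y : 𝔼 3) : ⟪((southPole : 𝕊 3) : 𝔼 4), uvec y⟫ = 0 :=
  Submodule.mem_orthogonal_singleton_iff_inner_right.mp (U.symm y).2

/-- `uvec y` has vanishing last coordinate. [folklore] -/
@[simp]
theorem uvec_apply_three (y : 𝔼 3) : uvec y 3 = 0 := by
  have h := inner_southPole_uvec y
  rw [coe_southPole, inner_neg_left, neg_eq_zero] at h
  have h3 : (Fin.last 3 : Fin 4) = 3 := rfl
  rw [EuclideanSpace.inner_single_left, h3] at h
  simpa using h

/-- `uvec` preserves norms. [folklore] -/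
@[simp]
theorem norm_uvec (y : 𝔼 3) : ‖uvec y‖ = ‖y‖ :=
  uvec.norm_map y

/-- `uvec` preserves inner products. [folklore] -/
@[simp]
theorem inner_uvec_uvec (y y' : 𝔼 3) : ⟪uvec y, uvec y'⟫ = ⟪y, y'⟫ :=
  uvec.inner_map_map y y'

/-- `uvec y` is orthogonal to `e₃`. [folklore] -/
@[simp]
theorem inner_uvec_e3 (y : 𝔼 3) : ⟪uvec y, e3⟫ = 0 := by
  rw [inner_e3_right, uvec_apply_three]

/-- `e₃` is orthogonal to `uvec y`. [folklore] -/
@[simp]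
theorem inner_e3_uvec (y : 𝔼 3) : ⟪e3, uvec y⟫ = 0 := by
  rw [real_inner_comm, inner_uvec_e3]

/-- The horizontal projection fixes `uvec y`. [folklore] -/
@[simp]
theorem projH_uvec (y : 𝔼 3) : projH (uvec y) = uvec y :=
  projH_of_apply_three (uvec_apply_three y)

/-- The south pole is `-e₃`. [folklore] -/
theorem coe_southPole_eq : ((southPole : 𝕊 3) : 𝔼 4) = -e3 := by
  rw [coe_southPole]; rfl

/-! ## The inverse chart in the frame -/

/-- **The inverse chart** `φ = (↑) ∘ ψ⁻¹` in the frame: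
`φ w = (‖w‖² + 4)⁻¹ (4 U⁻¹ w + (4 - ‖w‖²) e₃)`. [folklore] -/
theorem phi_eq (w : 𝔼 3) :
    phi w = (‖w‖ ^ 2 + 4)⁻¹ • ((4 : ℝ) • uvec w + (4 - ‖w‖ ^ 2) • e3) := by
  have h : phi w = (‖uvec w‖ ^ 2 + 4)⁻¹ • (4 : ℝ) • uvec w +
      (‖uvec w‖ ^ 2 + 4)⁻¹ • (‖uvec w‖ ^ 2 - 4) • ((southPole : 𝕊 3) : 𝔼 4) :=
    stereographic'_symm_apply (southPole : 𝕊 3) w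
  rw [norm_uvec, coe_southPole_eq] at h
  rw [h]
  module

/-- The last coordinate of `φ w` is `(4 - ‖w‖²)/(‖w‖² + 4)`. [folklore] -/
theorem phi_apply_three (w : 𝔼 3) : phi w 3 = (4 - ‖w‖ ^ 2) / (‖w‖ ^ 2 + 4) := by
  rw [phi_eq]
  simp [div_eq_inv_mul]

/-- The horizontal part of `φ w` is `4 (‖w‖² + 4)⁻¹ U⁻¹ w`. [folklore] -/
theorem projH_phi (w : 𝔼 3) : projH (phi w) = (4 * (‖w‖ ^ 2 + 4)⁻¹) • uvec w := by
  rw [phi_eq, map_smul, map_add, map_smul, map_smul, projH_uvec, projH_e3, smul_zero, add_zero,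
    smul_smul, mul_comm]

/-- The last coordinate of `φ w` is positive iff `‖w‖ < 2` (northern hemisphere = ball of
radius `2`). [folklore] -/
theorem phi_apply_three_pos_iff (w : 𝔼 3) : 0 < phi w 3 ↔ ‖w‖ < 2 := by
  rw [phi_apply_three]
  have h4 : 0 < ‖w‖ ^ 2 + 4 := by positivity
  rw [div_pos_iff_of_pos_right h4, sub_pos, show (4 : ℝ) = 2 ^ 2 by norm_num,
    sq_lt_sq, abs_norm, abs_of_pos two_pos]

/-- The last coordinate of `φ w` is negative iff `2 < ‖w‖`. [folklore] -/
theorem phi_apply_three_neg_iff (w : 𝔼 3) : phi w 3 < 0 ↔ 2 < ‖w‖ := by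
  rw [phi_apply_three]
  have h4 : 0 < ‖w‖ ^ 2 + 4 := by positivity
  rw [div_neg_iff]
  constructor
  · rintro (⟨-, h⟩ | ⟨h, -⟩)
    · exact absurd h4 (not_lt.2 h.le)
    · rw [sub_neg, show (4 : ℝ) = 2 ^ 2 by norm_num, sq_lt_sq, abs_norm, abs_of_pos two_pos] at h
      exact h
  · intro h
    refine Or.inr ⟨?_, h4⟩
    rw [sub_neg, show (4 : ℝ) = 2 ^ 2 by norm_num, sq_lt_sq, abs_norm, abs_of_pos two_pos]
    exact h

/-- The last coordinate of `φ w` vanishes iff `‖w‖ = 2` (the equator is the sphere of radius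
`2`). [folklore] -/
theorem phi_apply_three_eq_zero_iff (w : 𝔼 3) : phi w 3 = 0 ↔ ‖w‖ = 2 := by
  rw [phi_apply_three]
  have h4 : 0 < ‖w‖ ^ 2 + 4 := by positivity
  rw [div_eq_zero_iff, or_iff_left h4.ne', sub_eq_zero, eq_comm,
    show (4 : ℝ) = 2 ^ 2 by norm_num, sq_eq_sq₀ (norm_nonneg _) zero_le_two]

/-! ## The reflection `R` in the equatorial hyperplane, on vectors -/

/-- The reflection `x ↦ x - 2 x₃ e₃ = Π x - x₃ e₃` of `ℝ⁴` in the hyperplane `x₃ = 0`, as a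
continuous linear map (on the sphere it is `reflectLast 3`, `coe_reflectLast_three`). [folklore] -/
def refl4 : 𝔼 4 →L[ℝ] 𝔼 4 :=
  projH - (EuclideanSpace.proj (3 : Fin 4)).smulRight e3

/-- Unfolding of `refl4`. [folklore] -/
theorem refl4_apply (x : 𝔼 4) : refl4 x = projH x - (x 3) • e3 := rfl

/-- `reflectLast 3` on vectors is `refl4`. [folklore] -/
theorem coe_reflectLast_three_eq (x : 𝕊 3) : ((reflectLast 3 x : 𝕊 3) : 𝔼 4) = refl4 x := by
  rw [refl4_apply, coe_reflectLast_three]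

/-- `refl4` fixes horizontal vectors of the frame. [folklore] -/
@[simp]
theorem refl4_uvec (y : 𝔼 3) : refl4 (uvec y) = uvec y := by
  rw [refl4_apply, projH_uvec, uvec_apply_three, zero_smul, sub_zero]

/-- `refl4 e₃ = -e₃`. [folklore] -/
@[simp]
theorem refl4_e3 : refl4 e3 = -e3 := by
  rw [refl4_apply, projH_e3, zero_sub, e3_apply]
  simp

/-- `refl4` is an involution. [folklore] -/
@[simp]
theorem refl4_refl4 (x : 𝔼 4) : refl4 (refl4 x) = x := by
  rw [refl4_apply x, map_sub, map_smul, refl4_e3, refl4_apply, projH_projH, projH_apply_three,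
    zero_smul, sub_zero, smul_neg, sub_neg_eq_add, projH_add]

/-- The last coordinate changes sign under `refl4`. [folklore] -/
@[simp]
theorem refl4_apply_three (x : 𝔼 4) : refl4 x 3 = -(x 3) := by
  rw [refl4_apply]
  simp [projH_apply_three]

/-! ## The inversion in the sphere of radius `2` -/

/-- The inversion `w ↦ 4 w / ‖w‖²` of `ℝ³` in the sphere of radius `2` (the chart image of the
equator); it is the chart expression of the reflection `R` (`phi_inv3`). [folklore] -/
def inv3 (w : 𝔼 3) : 𝔼 3 := (4 / ‖w‖ ^ 2) • w

/-- Unfolding of `inv3`. [folklore] -/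
theorem inv3_apply (w : 𝔼 3) : inv3 w = (4 / ‖w‖ ^ 2) • w := rfl

/-- Norm of the inverted vector. [folklore] -/
theorem norm_inv3 {w : 𝔼 3} (hw : w ≠ 0) : ‖inv3 w‖ = 4 / ‖w‖ := by
  have hn : 0 < ‖w‖ := norm_pos_iff.2 hw
  rw [inv3_apply, norm_smul, Real.norm_eq_abs, abs_of_pos (by positivity)]
  field_simp

/-- The inversion of a positive multiple. [folklore] -/
theorem inv3_smul {c : ℝ} (hc : 0 < c) (w : 𝔼 3) : inv3 (c • w) = c⁻¹ • inv3 w := by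
  rw [inv3_apply, inv3_apply, norm_smul, Real.norm_eq_abs, abs_of_pos hc, smul_smul, smul_smul]
  rcases eq_or_ne w 0 with rfl | hw
  · simp
  · congr 1
    have hn : 0 < ‖w‖ := norm_pos_iff.2 hw
    field_simp

/-- **The inversion is the chart expression of the reflection `R`**: `φ (ι w) = R (φ w)` for
`w ≠ 0`. [folklore] -/
theorem phi_inv3 {w : 𝔼 3} (hw : w ≠ 0) : phi (inv3 w) = refl4 (phi w) := by
  have hn : 0 < ‖w‖ := norm_pos_iff.2 hw
  have hn2 : (0 : ℝ) < ‖w‖ ^ 2 := by positivity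
  rw [phi_eq, phi_eq, norm_inv3 hw, inv3_apply, map_smul, map_smul, map_add, map_smul, map_smul,
    refl4_uvec, refl4_e3]
  have h1 : ((4 / ‖w‖) ^ 2 + 4)⁻¹ * (4 * (4 / ‖w‖ ^ 2)) = (‖w‖ ^ 2 + 4)⁻¹ * 4 := by
    field_simp
    ring
  have h2 : ((4 / ‖w‖) ^ 2 + 4)⁻¹ * (4 - (4 / ‖w‖) ^ 2) = -((‖w‖ ^ 2 + 4)⁻¹ * (4 - ‖w‖ ^ 2)) := by
    field_simp
    ring
  simp only [smul_add, smul_smul, smul_neg]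
  rw [h1, h2, neg_smul]

/-- On the sphere: `ψ⁻¹ (ι w) = R (ψ⁻¹ w)` for `w ≠ 0`. [folklore] -/
theorem psi_symm_inv3 {w : 𝔼 3} (hw : w ≠ 0) : psi.symm (inv3 w) = reflectLast 3 (psi.symm w) := by
  apply Subtype.ext
  rw [coe_reflectLast_three_eq]
  exact phi_inv3 hw

/-! ## Rays: the chart images of the vertical great circles through the poles -/

/-- The radial chart coordinate `2 cos θ / (1 + sin θ)` of the point at angle `θ` of a vertical
great circle through the poles (`phi_ray`). [folklore] -/
def rayR (θ : ℝ) : ℝ := 2 * Real.cos θ / (1 + Real.sin θ)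

/-- `(2 cos θ / (1 + sin θ))² + 4 = 8 / (1 + sin θ)`. [folklore] -/
theorem rayR_sq_add_four {θ : ℝ} (hθ : 1 + Real.sin θ ≠ 0) : rayR θ ^ 2 + 4 = 8 / (1 + Real.sin θ) := by
  rw [rayR, div_pow]
  have hc : Real.cos θ ^ 2 = (1 - Real.sin θ) * (1 + Real.sin θ) := by
    nlinarith [Real.cos_sq_add_sin_sq θ]
  field_simp
  nlinarith [hc]

/-- The horizontal coefficient of `φ` on a ray is `cos θ`. [folklore] -/
theorem rayR_coeff_cos {θ : ℝ} (hθ : 1 + Real.sin θ ≠ 0) :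
    (rayR θ ^ 2 + 4)⁻¹ * (4 * rayR θ) = Real.cos θ := by
  rw [rayR_sq_add_four hθ, rayR]
  field_simp
  ring

/-- The vertical coefficient of `φ` on a ray is `sin θ`. [folklore] -/
theorem rayR_coeff_sin {θ : ℝ} (hθ : 1 + Real.sin θ ≠ 0) :
    (rayR θ ^ 2 + 4)⁻¹ * (4 - rayR θ ^ 2) = Real.sin θ := by
  have h := rayR_sq_add_four hθ
  have h' : rayR θ ^ 2 = 8 / (1 + Real.sin θ) - 4 := by linarith
  rw [h, h']
  field_simp
  ring

/-- **Rays are vertical great circles**: `φ ((2 cos θ / (1 + sin θ)) â) = cos θ U⁻¹ â + sin θ e₃`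
for a unit chart vector `â` (the great circle through `U⁻¹ â` on the equator and the two poles,
parametrised by the angle `θ` from the equator towards the north pole). [folklore] -/
theorem phi_ray {a : 𝔼 3} (ha : ‖a‖ = 1) {θ : ℝ} (hθ : 1 + Real.sin θ ≠ 0) :
    phi (rayR θ • a) = Real.cos θ • uvec a + Real.sin θ • e3 := by
  rw [phi_eq, norm_smul, Real.norm_eq_abs, ha, mul_one, sq_abs, map_smul, smul_add, smul_smul,
    smul_smul, smul_smul, mul_assoc, rayR_coeff_cos hθ, rayR_coeff_sin hθ]

/-- `1 + sin θ ≠ 0` for `θ ∈ (-π/2, 3π/2)`. [folklore] -/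
theorem one_add_sin_ne_zero {θ : ℝ} (h₁ : -(π / 2) < θ) (h₂ : θ < 3 * π / 2) :
    1 + Real.sin θ ≠ 0 := by
  intro h
  have hs : Real.sin θ = -1 := by linarith
  -- `sin θ = -1` forces `θ = -π/2 + 2kπ`
  have hc : Real.cos θ = 0 := by nlinarith [Real.cos_sq_add_sin_sq θ]
  obtain ⟨k, hk⟩ := Real.cos_eq_zero_iff.1 hc
  -- `θ = (2k+1) π/2` with `sin θ = -1`
  have hkb : (2 * (k : ℝ) + 1) * π / 2 < 3 * π / 2 := hk ▸ h₂
  have hka : -(π / 2) < (2 * (k : ℝ) + 1) * π / 2 := hk ▸ h₁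
  have hk1 : (k : ℝ) < 1 := by nlinarith [Real.pi_pos]
  have hk0 : (-1 : ℝ) < k := by nlinarith [Real.pi_pos]
  have : k = 0 := by
    have a : k < 1 := by exact_mod_cast hk1
    have b : -1 < k := by exact_mod_cast hk0
    omega
  subst this
  simp at hk
  rw [hk, Real.sin_pi_div_two] at hs
  norm_num at hs

/-! ## Flat models: a knot with a straight chart segment at the bottom, inside the ball `B(0, 2)` -/

/-- The base point `q = (0, 0, -1)` of the chart (the midpoint of the flat segment of a flat
model). [folklore] -/
def qbase : 𝔼 3 := -EuclideanSpace.single 2 1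

/-- Coordinates of `qbase`. [folklore] -/
@[simp]
theorem qbase_apply (i : Fin 3) : qbase i = if i = 2 then -1 else 0 := by
  simp only [qbase, PiLp.neg_apply]
  change -(EuclideanSpace.single (2 : Fin 3) (1 : ℝ)) i = _
  rw [show EuclideanSpace.single (2 : Fin 3) (1 : ℝ) i = if i = 2 then 1 else 0 from
    PiLp.single_apply 2 ℝ 2 1 i]
  split_ifs <;> simp

/-- `‖qbase‖ = 1`. [folklore] -/
@[simp]
theorem norm_qbase : ‖qbase‖ = 1 := by
  simp [qbase]

/-- **A flat model**: a knot `A` off the south pole, inside the open northern hemisphere (chart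
image in `B(0, 2)`), whose chart image lies at height `≥ -1`, contains the horizontal segment
`{q + s e : |s| ≤ ℓ}` through `q = (0, 0, -1)` traversed by the parameters `[α, β]` through the
increasing function `σ` (`σ θ₁ = 0`), and meets the slab `{|⟪z - q, e⟫| < ℓ, z₂ < -1 + ν}` only in
that segment. (The output of `Knot.exists_flatArc_param`, normalised by a homothety of the chart;
`exists_flatModel`.) [folklore] -/
structure FlatModel where
  /-- The knot. -/
  A : Knot
  /-- The (horizontal, unit) direction of the flat segment in the chart. -/
  e : 𝔼 3
  /-- Half-length of the flat segment. -/
  ℓ : ℝ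
  /-- Height of the slab met only by the segment. -/
  ν : ℝ
  /-- Start of the parameter window of the segment. -/
  α : ℝ
  /-- End of the parameter window of the segment. -/
  β : ℝ
  /-- The parameter of the midpoint `q` of the segment. -/
  θ₁ : ℝ
  /-- The coordinate of the segment as a function of the parameter. -/
  σ : ℝ → ℝ
  /-- `A` misses the south pole. -/
  ne_southPole : ∀ x, A x ≠ southPole
  /-- `A` lies in the open northern hemisphere. -/
  norm_lt_two : ∀ x, ‖psi (A x)‖ < 2
  /-- `e` is a unit vector. -/
  norm_e : ‖e‖ = 1
  /-- `e` is horizontal. -/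
  e_two : e 2 = 0
  /-- `ℓ > 0`. -/
  ℓ_pos : 0 < ℓ
  /-- `ℓ ≤ 1/2`. -/
  ℓ_le : ℓ ≤ 2⁻¹
  /-- `ν > 0`. -/
  ν_pos : 0 < ν
  /-- `α < θ₁`. -/
  α_lt : α < θ₁
  /-- `θ₁ < β`. -/
  lt_β : θ₁ < β
  /-- The window is shorter than a period. -/
  β_lt : β < α + 2 * π
  /-- `σ` is smooth. -/
  contDiff_σ : ContDiff ℝ ∞ σ
  /-- `σ` is increasing on the window. -/
  deriv_σ_pos : ∀ θ ∈ Icc α β, 0 < deriv σ θ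
  /-- `σ θ₁ = 0`. -/
  σ_θ₁ : σ θ₁ = 0
  /-- `σ α = -ℓ`. -/
  σ_α : σ α = -ℓ
  /-- `σ β = ℓ`. -/
  σ_β : σ β = ℓ
  /-- The chart image of `A` lies at height `≥ -1`. -/
  height : ∀ x, -1 ≤ psi (A x) 2
  /-- The slab below height `-1 + ν` over the segment meets `A` only in the segment. -/
  box : ∀ x, |⟪psi (A x) - qbase, e⟫| < ℓ → psi (A x) 2 < -1 + ν →
    ∃ s ∈ Icc (-ℓ) ℓ, psi (A x) = qbase + s • e
  /-- The segment is traversed by the window `[α, β]` through `σ`. -/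
  seg : ∀ θ ∈ Icc α β, psi (A (circlePoint θ)) = qbase + σ θ • e

/-- Transport of a knot off the south pole by a homothety of the chart: for `μ > 0` and points
`p`, `q` there is an isotopic knot `A` off the south pole with `ψ (A x) = q + μ (ψ (K x) - p)`
(the affine ambient isotopy `AffineIsotopy.exists_ambientIsotopy_affine` transported along `ψ`,
`AmbientIsotopy.alongChart`). [folklore] -/
theorem exists_map_homothety (K : Knot) (hK : ∀ x, K x ≠ southPole) (p q : 𝔼 3) {μ : ℝ}
    (hμ : 0 < μ) : ∃ A : Knot, K.IsIsotopic A ∧ (∀ x, A x ≠ southPole) ∧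
      ∀ x, psi (A x) = q + μ • (psi (K x) - p) := by
  -- the chart image of `K` is compact
  have hcont : Continuous fun x : 𝕊 1 ↦ psi (K x) :=
    contMDiffOn_psi.continuousOn.comp_continuous K.continuous fun x ↦ mem_psi_source (hK x)
  obtain ⟨C, hC⟩ := (isCompact_range hcont).isBounded.subset_closedBall p
  set L₁ : 𝔼 3 ≃L[ℝ] 𝔼 3 := smulEquiv hμ.ne' (ContinuousLinearEquiv.refl ℝ (𝔼 3))
    with hL₁
  have hdet : 0 < (AffineIsotopy.toMat ((ContinuousLinearEquiv.refl ℝ (𝔼 3) : 𝔼 3 ≃L[ℝ] 𝔼 3) :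
      𝔼 3 →L[ℝ] 𝔼 3)).det * (AffineIsotopy.toMat (L₁ : 𝔼 3 →L[ℝ] 𝔼 3)).det := by
    rw [hL₁, toMat_smulEquiv, Matrix.det_smul, ContinuousLinearEquiv.coe_refl,
      AffineIsotopy.toMat_id, Matrix.det_one, Fintype.card_fin, mul_one, one_mul]
    positivity
  obtain ⟨F, hF1, R, hR⟩ := AffineIsotopy.exists_ambientIsotopy_affine p q p
    (ContinuousLinearEquiv.refl ℝ (𝔼 3)) L₁ hdet C
  set G := F.alongChart (φ := psi) contMDiffOn_psi contMDiff_psi_symm psi_target hR with hG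
  refine ⟨K.map (G.toDiffeomorph 1), K.isIsotopic_map G, fun x ↦ ?_, fun x ↦ ?_⟩
  · change G.toFun 1 (K x) ≠ southPole
    rw [hG, AmbientIsotopy.alongChart_toFun, chartTransport_of_mem _ (mem_psi_source (hK x))]
    exact psi_symm_ne_southPole _
  · change psi (G.toFun 1 (K x)) = _
    rw [hG, AmbientIsotopy.alongChart_toFun, chartTransport_of_mem _ (mem_psi_source (hK x)),
      psi_apply_psi_symm]
    have h := hF1 (psi (K x)) (hC ⟨x, rfl⟩)
    simp only [ContinuousLinearEquiv.coe_refl', id_eq, add_sub_cancel] at h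
    rw [h, hL₁, smulEquiv_apply, ContinuousLinearEquiv.coe_refl', id_eq]

/-- **Every knot has a flat model**: `K` is isotopic to the knot of some flat model
(`Knot.exists_flatArc_param` followed by the homothety of the chart that scales the picture into
the ball `B(0, 2)` and puts the midpoint of the segment at `q = (0, 0, -1)`). [folklore] -/
theorem exists_flatModel (K : Knot) : ∃ Φ : FlatModel, K.IsIsotopic Φ.A := by
  obtain ⟨K', hKK', hK', p, e, ℓ, ν, he, he2, hℓ, hν, hheight, hbox, α, θ₁, β, σ, hαθ, hθβ, hβα,
    hσ, hσ', hσ₁, hσα, hσβ, hseg⟩ := K.exists_flatArc_param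
  have hcont : Continuous fun x : 𝕊 1 ↦ psi (K' x) :=
    contMDiffOn_psi.continuousOn.comp_continuous K'.continuous fun x ↦ mem_psi_source (hK' x)
  obtain ⟨C, hC⟩ := (isCompact_range hcont).isBounded.subset_closedBall p
  have hCx : ∀ x, ‖psi (K' x) - p‖ ≤ |C| := fun x ↦
    (mem_closedBall_iff_norm.1 (hC ⟨x, rfl⟩)).trans (le_abs_self C)
  set μ : ℝ := 1 / (2 * (|C| + ℓ + 1)) with hμ
  have hden : 0 < |C| + ℓ + 1 := by positivity
  have hμpos : 0 < μ := by positivity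
  have hμC : μ * |C| ≤ 2⁻¹ := by
    rw [hμ, div_mul_eq_mul_div, one_mul, div_le_iff₀ (by positivity)]
    nlinarith [abs_nonneg C]
  have hμℓ : μ * ℓ ≤ 2⁻¹ := by
    rw [hμ, div_mul_eq_mul_div, one_mul, div_le_iff₀ (by positivity)]
    nlinarith [abs_nonneg C]
  obtain ⟨A, hA, hAne, hApsi⟩ := exists_map_homothety K' hK' p qbase hμpos
  have hcoord : ∀ x, psi (A x) 2 = -1 + μ * (psi (K' x) 2 - p 2) := fun x ↦ by
    rw [hApsi]
    simp
  have hdiffσ : Differentiable ℝ σ := hσ.differentiable (by simp)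
  refine ⟨
    { A := A, e := e, ℓ := μ * ℓ, ν := μ * ν, α := α, β := β, θ₁ := θ₁, σ := fun θ ↦ μ * σ θ
      ne_southPole := hAne, norm_lt_two := fun x ↦ ?_, norm_e := he, e_two := he2
      ℓ_pos := by positivity, ℓ_le := hμℓ, ν_pos := by positivity, α_lt := hαθ, lt_β := hθβ
      β_lt := hβα, contDiff_σ := contDiff_const.mul hσ, deriv_σ_pos := fun θ hθ ↦ ?_
      σ_θ₁ := by simp [hσ₁], σ_α := by rw [hσα]; ring, σ_β := by rw [hσβ]
      height := fun x ↦ ?_, box := fun x h1 h2 ↦ ?_, seg := fun θ hθ ↦ ?_ },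
    SphereEmbedding.IsIsotopic.trans_holds hKK' hA⟩
  · -- inside the ball of radius `2`
    rw [hApsi]
    calc ‖qbase + μ • (psi (K' x) - p)‖ ≤ ‖qbase‖ + ‖μ • (psi (K' x) - p)‖ := norm_add_le _ _
      _ = 1 + μ * ‖psi (K' x) - p‖ := by
        rw [norm_qbase, norm_smul, Real.norm_eq_abs, abs_of_pos hμpos]
      _ ≤ 1 + μ * |C| := by gcongr; exact hCx x
      _ < 2 := by linarith
  · -- the derivative of `μ σ`
    rw [deriv_const_mul μ (hdiffσ θ)]
    exact mul_pos hμpos (hσ' θ hθ)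
  · -- height
    rw [hcoord]
    nlinarith [hheight x]
  · -- the box
    rw [hApsi, add_sub_cancel_left, real_inner_smul_left, abs_mul, abs_of_pos hμpos] at h1
    rw [hcoord] at h2
    have h1' : |⟪psi (K' x) - p, e⟫| < ℓ := lt_of_mul_lt_mul_left (by linarith) hμpos.le
    have h2' : psi (K' x) 2 < p 2 + ν := by nlinarith
    obtain ⟨s, hs, hse⟩ := hbox x h1' h2'
    refine ⟨μ * s, ⟨by nlinarith [hs.1], by nlinarith [hs.2]⟩, ?_⟩
    rw [hApsi, hse, add_sub_cancel_left, smul_smul]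
  · -- the segment
    rw [hApsi, hseg θ hθ, add_sub_cancel_left, smul_smul]

end FoxMilnorModel

end Literature.Topology.FourManifolds
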